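import Literature.IUT.HodgeArakelov.IotaInvariantThetaInftyHolds
import Literature.AnabelianGeometry.EtaleTheta.Discharge.Sec1ThetaCompactOfYcl
import Literature.AnabelianGeometry.EtaleTheta.ThetaSettingOriginClauses

/-!
# [IUTchII] Prop 2.2 (ii) «respectively» clause AT THE MODEL — the topological binder
# «`Δ_Θ` compact, `(Π^tp_X)^Θ` Hausdorff» (GAP-LEDGER G-w5d187-1) RE-POINTED to the `Π_X`-side clause `hYcl`
# (G-w4d021-2) + R3 + the §6 parameter bundle

S. Mochizuki, *Inter-universal Teichmüller theory II*, kurims manuscript (Dec. 2020), §2 Prop. 2.2 (ii) p. 66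
l. 56–61 («determines a specific … `μ`-orbit … `∞θ^ι(Π_v) ⊆ ∞θ(Π_v)` within each `{(l·ℤ) × μ}`-orbit»)
[claim: Mochizuki2012, status: disputed]; *The étale theta function …* [EtTh] §1, PRIMS PDF pp. 12–13
(«(Ẑ(1) ≅) Δ_Θ», «a natural exact sequence of abelian profinite groups `1 → Δ_Θ → (Δ^tp_Y)^Θ → (Δ^tp_Y)^ell → 1`»)
[cite: MochizukiEtTh2009, §1 p.12].  abc-iut cell, layer L6, node **IUTchII:Prop2.2(ii)**, sub-DAG row
Prop-22.ii.r13a (seat abc-iut-w5-d187, gen 3).  PROOF-ONLY companion; no definition; nothing of any other seat's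
file is restated.

THE SITUATION.  This lineage's capstone `EtaleThetaDataOfSetting.inftyClause_of_cyclotomeTower_of_prop15iii`
(`IotaInvariantThetaInftyHolds.lean`, p422154) proves the clause at the model modulo the named inputs
{`IsEtThOrigin` (F-2498), a `CyclotomeTower` (G-L2t10-1 data), `Prop15iii` (F-0591)} and the Θ-SIDE topological
binder `hΔ : IsCompact Δ_Θ` + `[T2Space (Π^tp_X)^Θ]` (G-w5d187-1) — the latter certified NOT derivable from the root
interface (abc-iut-w5-d028, `SettingModel.hDelta_not_derivable`).  abc-iut-w5-d111's
`ThetaSetting.isCompact_deltaTheta_of_closure_map_dtpY_le` / `…_of_groupLevelData` and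
`ThetaSetting.t2Space_gtpTheta_of_isQuotientMap` (`Discharge/Sec1ThetaCompactOfYcl.lean`) derive BOTH halves of that
binder from the `Π_X`-side clause `hYcl` («the image of `Δ^tp_Y` in `Δ^Θ_X = Δ_X/[[Δ_X,Δ_X],Δ_X]⁻` is closed»,
G-w4d021-2), temperedness + Galois-countability of `Π^tp_X` (the §6 parameter bundle
`D.toTemperedCurve.GroupLevelData`, ruling η′) and the quotient-topology clause R3 (`IsQuotientMap D.toTheta`,
a field of `ThetaSetting.IsThm16Origin`).  THIS FILE composes: the hΔ-consumers of this lineage —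
`exists_root_lDeltaTheta`, `toLim_nsmul_of_torsion`, `hdiv_of_cyclotomeTower_of_prop15iii` and the capstone — hold
with G-w5d187-1 REPLACED by {`hYcl`, R3, tempered + first-countable `Π^tp_X`} (resp. the `GroupLevelData` /
`IsThm16Origin` packagings).  NET for the node's bookkeeping: the «respectively» clause of [IUTchII] Prop. 2.2 (ii)
at the model now rests on {F-2498, G-L2t10-1, F-0591, G-w4d021-2, R3, §6 bundle} — G-w5d187-1 is no longer a
residual of this row (it FOLLOWS from G-w4d021-2 + R3 + the bundle, abc-iut-w5-d111).  Typed ≠ proved for the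
residual inputs; nothing of [IUTchII]/[EtTh] is asserted; no side is taken on [IUTchIII] Cor. 3.12.
-/

namespace Literature.IUT.HodgeArakelov

open Literature.AnabelianGeometry.EtaleTheta Literature.AnabelianGeometry.SemiGraphs
open EtaleThetaDataOfSetting _root_.Topology

noncomputable section

namespace EtaleThetaDataOfSetting

variable {p : ℕ} [Fact p.Prime] {D : Literature.AnabelianGeometry.EtaleTheta.ThetaSetting p}
  {E : D.EtaleThetaData} {l : ℕ} (C : E.DoubleUnderline l)

/-! ### The two base lemmas of `IotaInvariantThetaInftyDivisible` with `hΔ`/`T2Space` re-pointed -/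

/-- Continuous `N`-th roots on the `N`-th powers of `l·Δ_Θ` — `exists_root_lDeltaTheta` with the binder
«`Δ_Θ` compact, `(Π^tp_X)^Θ` Hausdorff» supplied from `hYcl` (G-w4d021-2), `Π^tp_X` tempered first-countable,
and R3. [cite: MochizukiEtTh2009, §1 p.12] -/
theorem exists_root_lDeltaTheta_of_hYcl (hO : D.IsEtThOrigin) (hT : IsTempered D.PiTemp)
    [FirstCountableTopology D.PiTemp]
    (hYcl : (D.DtpY.map D.toHat.toMonoidHom).topologicalClosure ≤
      D.DtpY.map D.toHat.toMonoidHom ⊔ (⁅⁅D.DeltaHat, D.DeltaHat⁆, D.DeltaHat⁆).topologicalClosure)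
    (hq : IsQuotientMap D.toTheta) {N : ℕ} (hN : N ≠ 0) :
    ∃ r : {a : D.lDeltaTheta l // ∃ b : D.lDeltaTheta l, b ^ N = a} → D.lDeltaTheta l,
      Continuous r ∧ ∀ a, (r a) ^ N = a.1 := by
  haveI := D.t2Space_gtpTheta_of_isQuotientMap hq
  exact exists_root_lDeltaTheta (l := l) hO (D.isCompact_deltaTheta_of_closure_map_dtpY_le hT hYcl) hN

/-- **Torsion classes of `H¹(Π^tp_Ÿ̲̲, l·Δ_Θ)` are divisible in `lim_J`** — `toLim_nsmul_of_torsion` with G-w5d187-1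
re-pointed to `hYcl` + tempered first-countable `Π^tp_X` + R3. [claim: Mochizuki2012, status: disputed]
(IUTchII §1 Prop 1.4, kurims p.27) -/
theorem toLim_nsmul_of_torsion_of_hYcl (hO : D.IsEtThOrigin) (hT : IsTempered D.PiTemp)
    [FirstCountableTopology D.PiTemp]
    (hYcl : (D.DtpY.map D.toHat.toMonoidHom).topologicalClosure ≤
      D.DtpY.map D.toHat.toMonoidHom ⊔ (⁅⁅D.DeltaHat, D.DeltaHat⁆, D.DeltaHat⁆).topologicalClosure)
    (hq : IsQuotientMap D.toTheta) (mods : ∀ M : ℕ+, D.CyclotomeMod l M) (τ : (coh C).H1 ⊤) (hτ : l • τ = 0)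
    {N : ℕ} (hN : 0 < N) : ∃ x : (coh C).lim, N • x = (coh C).toLim ⊤ τ := by
  haveI := D.t2Space_gtpTheta_of_isQuotientMap hq
  exact toLim_nsmul_of_torsion C hO (D.isCompact_deltaTheta_of_closure_map_dtpY_le hT hYcl) mods τ hτ hN

/-! ### (hdiv) and the «respectively» clause at the model, G-w5d187-1 re-pointed -/

/-- **(hdiv) at the model** from a cyclotome tower and [EtTh] Prop. 1.5 (iii), with the topological binder supplied
from `hYcl` + tempered first-countable `Π^tp_X` + R3. [claim: Mochizuki2012, status: disputed]
(IUTchII §2 Prop 2.2 (ii), kurims p.66) -/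
theorem hdiv_of_cyclotomeTower_of_prop15iii_of_hYcl (hO : D.IsEtThOrigin) (hT : IsTempered D.PiTemp)
    [FirstCountableTopology D.PiTemp]
    (hYcl : (D.DtpY.map D.toHat.toMonoidHom).topologicalClosure ≤
      D.DtpY.map D.toHat.toMonoidHom ⊔ (⁅⁅D.DeltaHat, D.DeltaHat⁆, D.DeltaHat⁆).topologicalClosure)
    (hq : IsQuotientMap D.toTheta) {Es : Set ℕ+} (τ : D.CyclotomeTower l Es) (hC : D.Compat) (hS : D.Sec2Hyps)
    (h15 : ThetaSetting.Prop15iii E hC) (hchar : PiYddCharacteristic C) (S : BadPlaceSetting.{0})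
    (eS : (Pi C) ≃ₜ* S.PiX) (hl : S.l = l) :
    ∀ t ∈ (etaleThetaDataOfSetting' C hC hS hchar S.toThetaSetting eS hl).theta, ∀ N : ℕ, 0 < N →
      ∃ x : (coh C).lim, N • x = (coh C).toLim ⊤ t := by
  haveI := D.t2Space_gtpTheta_of_isQuotientMap hq
  exact hdiv_of_cyclotomeTower_of_prop15iii C hO τ (D.isCompact_deltaTheta_of_closure_map_dtpY_le hT hYcl)
    hC hS h15 hchar S eS hl

/-- **IUTchII:Prop2.2(ii) «respectively» clause AT THE MODEL, G-w5d187-1 RE-POINTED**: `InftyClause` holds for every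
`IotaInvariantTheta'` datum over `D := etaleThetaDataOfSetting'`, modulo ONLY: `IsEtThOrigin` (F-2498), a cyclotome
tower (G-L2t10-1 data), `Prop15iii` (F-0591), the `Π_X`-side clause `hYcl` (G-w4d021-2), `Π^tp_X` tempered
first-countable, and R3 (`IsQuotientMap toTheta`). [claim: Mochizuki2012, status: disputed]
(IUTchII §2 Prop 2.2 (ii), kurims p.66) -/
theorem inftyClause_of_cyclotomeTower_of_prop15iii_of_hYcl (hO : D.IsEtThOrigin) (hT : IsTempered D.PiTemp)
    [FirstCountableTopology D.PiTemp]
    (hYcl : (D.DtpY.map D.toHat.toMonoidHom).topologicalClosure ≤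
      D.DtpY.map D.toHat.toMonoidHom ⊔ (⁅⁅D.DeltaHat, D.DeltaHat⁆, D.DeltaHat⁆).topologicalClosure)
    (hq : IsQuotientMap D.toTheta) {Es : Set ℕ+} (τ : D.CyclotomeTower l Es) (hC : D.Compat) (hS : D.Sec2Hyps)
    (h15 : ThetaSetting.Prop15iii E hC) (hchar : PiYddCharacteristic C) (S : BadPlaceSetting.{0})
    (eS : (Pi C) ≃ₜ* S.PiX) (hl : S.l = l) {T : TemperedCoverings S (Pi C)}
    {Dec : SubgraphDecomposition S T (etaleThetaDataOfSetting' C hC hS hchar S.toThetaSetting eS hl)}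
    (Θ : IotaInvariantTheta' Dec) : Θ.InftyClause := by
  haveI := D.t2Space_gtpTheta_of_isQuotientMap hq
  exact inftyClause_of_cyclotomeTower_of_prop15iii C hO τ (D.isCompact_deltaTheta_of_closure_map_dtpY_le hT hYcl)
    hC hS h15 hchar S eS hl Θ

/-! ### Packagings: the §6 parameter bundle `GroupLevelData`; the origin clauses `IsThm16Origin` (R3) -/

/-- The clause with the §6 parameter bundle `d : D.toTemperedCurve.GroupLevelData` (ruling η′: `Π^tp_X` tempered,
Galois-countable) in place of the explicit temperedness/countability hypotheses; `hYcl` and R3 explicit.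
[claim: Mochizuki2012, status: disputed] (IUTchII §2 Prop 2.2 (ii), kurims p.66) -/
theorem inftyClause_of_cyclotomeTower_of_prop15iii_of_groupLevelData (hO : D.IsEtThOrigin)
    (d : D.toTemperedCurve.GroupLevelData)
    (hYcl : (D.DtpY.map D.toHat.toMonoidHom).topologicalClosure ≤
      D.DtpY.map D.toHat.toMonoidHom ⊔ (⁅⁅D.DeltaHat, D.DeltaHat⁆, D.DeltaHat⁆).topologicalClosure)
    (hq : IsQuotientMap D.toTheta) {Es : Set ℕ+} (τ : D.CyclotomeTower l Es) (hC : D.Compat) (hS : D.Sec2Hyps)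
    (h15 : ThetaSetting.Prop15iii E hC) (hchar : PiYddCharacteristic C) (S : BadPlaceSetting.{0})
    (eS : (Pi C) ≃ₜ* S.PiX) (hl : S.l = l) {T : TemperedCoverings S (Pi C)}
    {Dec : SubgraphDecomposition S T (etaleThetaDataOfSetting' C hC hS hchar S.toThetaSetting eS hl)}
    (Θ : IotaInvariantTheta' Dec) : Θ.InftyClause := by
  haveI := D.t2Space_gtpTheta_of_isQuotientMap hq
  exact inftyClause_of_cyclotomeTower_of_prop15iii C hO τ (D.isCompact_deltaTheta_of_groupLevelData d hYcl)
    hC hS h15 hchar S eS hl Θ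

/-- The clause at a setting satisfying the ORIGIN CLAUSES `IsThm16Origin` (which carry R3 =
`isQuotientMap_toTheta`) with the §6 bundle: residual = {`IsEtThOrigin`, `IsThm16Origin`, `GroupLevelData`, `hYcl`,
`CyclotomeTower`, `Prop15iii`} — every item a NAMED input of the cell; G-w5d187-1 eliminated.
[claim: Mochizuki2012, status: disputed] (IUTchII §2 Prop 2.2 (ii), kurims p.66) -/
theorem inftyClause_of_cyclotomeTower_of_prop15iii_of_thm16Origin (hO : D.IsEtThOrigin)
    (h16 : D.IsThm16Origin) (d : D.toTemperedCurve.GroupLevelData)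
    (hYcl : (D.DtpY.map D.toHat.toMonoidHom).topologicalClosure ≤
      D.DtpY.map D.toHat.toMonoidHom ⊔ (⁅⁅D.DeltaHat, D.DeltaHat⁆, D.DeltaHat⁆).topologicalClosure)
    {Es : Set ℕ+} (τ : D.CyclotomeTower l Es) (hC : D.Compat) (hS : D.Sec2Hyps)
    (h15 : ThetaSetting.Prop15iii E hC) (hchar : PiYddCharacteristic C) (S : BadPlaceSetting.{0})
    (eS : (Pi C) ≃ₜ* S.PiX) (hl : S.l = l) {T : TemperedCoverings S (Pi C)}
    {Dec : SubgraphDecomposition S T (etaleThetaDataOfSetting' C hC hS hchar S.toThetaSetting eS hl)}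
    (Θ : IotaInvariantTheta' Dec) : Θ.InftyClause :=
  inftyClause_of_cyclotomeTower_of_prop15iii_of_groupLevelData C hO d hYcl h16.isQuotientMap_toTheta τ hC hS h15
    hchar S eS hl Θ

/-- Under R3 the two root-clause candidates are INTERCHANGEABLE for this row: with `Π^tp_X` tempered first-countable
and `toTheta` a quotient map, the Θ-side binder of G-w5d187-1 holds iff ... — precisely, `hYcl` ⇒ (`Δ_Θ` compact ∧
`(Π^tp_X)^Θ` Hausdorff), and conversely (`(Δ^tp_Y)^Θ` compact) ⇒ `hYcl` (abc-iut-L5-t14); recorded here in the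
form the consumers use: the PAIR demanded by G-w5d187-1 follows from `hYcl`. [cite: MochizukiEtTh2009, §1 p.12] -/
theorem isCompact_deltaTheta_and_t2Space_of_hYcl (hT : IsTempered D.PiTemp) [FirstCountableTopology D.PiTemp]
    (hYcl : (D.DtpY.map D.toHat.toMonoidHom).topologicalClosure ≤
      D.DtpY.map D.toHat.toMonoidHom ⊔ (⁅⁅D.DeltaHat, D.DeltaHat⁆, D.DeltaHat⁆).topologicalClosure)
    (hq : IsQuotientMap D.toTheta) :
    IsCompact (D.DeltaTheta : Set D.GtpTheta) ∧ T2Space D.GtpTheta :=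
  ⟨D.isCompact_deltaTheta_of_closure_map_dtpY_le hT hYcl, D.t2Space_gtpTheta_of_isQuotientMap hq⟩

end EtaleThetaDataOfSetting

end

end Literature.IUT.HodgeArakelov
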